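import Summits.BirchSwinnertonDyer.BirchSwinnertonDyer.Theorems.GenusKolyvaginAtTwoEquivariantChebotarevAtTwoRefutation

/-!
# Route `GenusKolyvaginAtTwo`, item stmt-BirchSwinnertonDyer-24882 `EquivariantKolyvaginExactAtTwo`
# (aside, rank 304) holds VACUOUSLY

The route decl `EquivariantKolyvaginExactAtTwo` (Q3 of the LINE-6 split of crux 22137, demoted to an
*aside* at route rev 14 and restated 1:1 as `EquivariantKolyvaginExactAtTwoR`, stmt-27720) is the
implication

  `KolyvaginRelationAtTwo → EquivariantChebotarevAtTwo → (Q1-shape) → (KolyvaginExactAtTwo on Δ < 0)`.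

Its SECOND antecedent, the retired Q5 `EquivariantChebotarevAtTwo` (stmt-24881), is REFUTED in the tree:
`GenusExact.not_EquivariantChebotarevAtTwo` (seat gk2-p2 g8, file
`GenusKolyvaginAtTwoEquivariantChebotarevAtTwoRefutation.lean`; witness `433a1`, `K = ℚ(√−433)`).  Hence the
implication holds with no mathematical content: this file records the VACUOUS closure so that the ledger
no longer lists 24882 as open (operator verb `workitem relabel … vacuous` applies).  Nothing here bears on
the live Q3R (stmt-27720 / 28029 / 28030) or on crux 22137; BSD is not proved by this file.
-/

set_option linter.dupNamespace false -- tree convention: `Summit.BirchSwinnertonDyer.BirchSwinnertonDyer.Theorems` (summit = sub-problem)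

namespace Summit.BirchSwinnertonDyer.BirchSwinnertonDyer.Theorems

open Summit.BirchSwinnertonDyer.BirchSwinnertonDyer.Theses.GenusKolyvaginAtTwo

/-- **Item stmt-BirchSwinnertonDyer-24882 holds vacuously.** The route decl
`EquivariantKolyvaginExactAtTwo` takes the refuted Q5 `EquivariantChebotarevAtTwo` (stmt-24881) as its
second antecedent; `GenusExact.not_EquivariantChebotarevAtTwo` (tree, p620924) discharges it by
`absurd`.  VACUOUS closure — no statement about Kolyvagin systems is proved. [folklore] -/
theorem equivariantKolyvaginExactAtTwo_proof : EquivariantKolyvaginExactAtTwo := by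
  unfold EquivariantKolyvaginExactAtTwo
  intro _ hQ5
  exact absurd hQ5 GenusExact.not_EquivariantChebotarevAtTwo

end Summit.BirchSwinnertonDyer.BirchSwinnertonDyer.Theorems
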